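/-
Copyright (c) 2026. All rights reserved.
Released under Apache 2.0 license as described in the file LICENSE.
Authors: abc-iut cell, prover seat abc-iut-w4-d095 (wave 4), over the statements of abc-iut-L4-t3, the reductions of
abc-iut-w5-d097 and the MLF model of abc-iut-L4-t9 (see the imports).
-/
import Literature.AnabelianGeometry.AbsoluteAnabelian.LogFrobeniusLogWallArchOrigin
import Literature.AnabelianGeometry.AbsoluteAnabelian.LogFrobeniusLogWallNonarchOrigin
import Literature.AnabelianGeometry.AbsoluteAnabelian.AbsTopIII.MLFLogFrobeniusNonarchArrows
import Literature.AnabelianGeometry.AbsoluteAnabelian.LogFrobeniusObservablesOfIotaSquare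
import Mathlib.CategoryTheory.Products.Basic
import HarnessLib

/-!
# [AbsTopIII] Corollary 5.5 (iv), print-faithful sentences 1 and 2, AT THE SETTING WITH GENUINE NONARCHIMEDEAN COMPONENTS

S. Mochizuki, *Topics in absolute anabelian geometry III: global reconstruction algorithms*, J. Math. Sci. Univ.
Tokyo 22 (2015) 939–1156 [MochizukiAbsTopIII2015]; locators = pages of the author's manuscript
(`paper:url-5493eb38cbb7`): Cor 5.5 (iv) p. 131; Def 5.4 (iii) p. 126 (the nonarchimedean graph `Γ⃗^log_v`),
Def 5.4 (iv) p. 127 (`𝒩⊞_v := Orb(𝒞^{MLF-sB}_{TS⊞}) ×_{Orb(TG),v} Th•[Z]`, `𝒩_v := Orb(𝒞^{MLF-sB}_{TS}) ×_{Orb(TG),v} Th•[Z]`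
— fibred products of the LOCAL pair categories with the global base — and the functors `λ⊞_{v,ν}`), Def 5.4 (vii)
p. 128 (`ι⊞_{v,ε}`, `ι_{v,ε}`).

The nonarchimedean companion of `LogFrobeniusLogWallArchOrigin.lean`: a labelled MODEL setting plus two theorems.

* `LogFrobeniusSetting.nonarchGenuine p Vmod isArc` — over any index set (one universe up, `Up`), the §5 setting
  whose NONARCHIMEDEAN local components are GENUINE: `𝒳 :=` abc-iut-L4-t9's model MLF-Galois `TF`-pairs
  `(Π_k ↠ G_k ↷ ℚ̄_p)` (`TFModel p`), `log` the identity (log-coordinates, as in that model),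
  `𝒩⊞_v = 𝒩_v := 𝒳 × 𝒞_TS` ("base × local `TS`-pairs": print's fibred product over `Orb(TG)` RELAXED to a product,
  `TSObj` = abc-iut-L4-t9's model `TS`-pairs), `λ⊞_{v,ν}(A) := (A, λ_ν(A))` with `λ_ν` the six vertices of Def 5.4 (iii)
  at the model (`lamUnits` `𝒪^×_k̄`, `lamTimes` `k̄^×`, `lamAdd` `k̄` / `k~` (log-coordinates), `lamTimesPf` `(k̄^×)^pf`,
  `MLFLogFrobeniusNonarchArrows.lean`), `ι⊞_{v,ε} := (𝟙, ι_ε)` with `ι_ε` the genuine arrows there (in particular the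
  shell-arrow = the genuine `p`-adic logarithm), and its `TS`-datum `nonarchGenuineTS` (all six arrows, including the
  `TS`-only `k̄^× ↪ k̄`).  PLACEHOLDERS (honest label): `ℰ• := 𝒳` with `𝒩_v → ℰ•` the first projection (print: the base
  `Th•[Z]`), `An•[𝒳] := 𝒳` with identity equivalences (print: Cor 5.2 (iv)), the ARCHIMEDEAN components (constant
  `(A, λ_{k̄}(A))`, identity arrows) and the whole mono-analytic side — Cor 5.5 (iv) reads none of them.
* `LogFrobeniusSetting.nonarchGenuine_cor55LogWall_and_notSimCompat` — at that setting with its `TS`-datum, over every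
  index set with a nonarchimedean place and for every model `TF`-pair `x₀`, BOTH print-faithful sentences of Cor 5.5
  (iv) hold: `Cor55LogWall` (F-3082) and `Cor55NotSimultaneouslyCompatible` (F-3190) — by
  `cor55LogWall_and_notSimCompat_of_iota_injective` (`LogFrobeniusLogWallNonarchOrigin.lean`) with `Ψ :=` the underlying
  arithmetic datum of the local pair: `𝒪^× ↪ k̄^× ↪ k̄` and `k~ →(id) k~` are injective, `log_k̄` is not
  (`MLFLogFrobeniusNonarchArrows.lean`).  MODEL-LEVEL; contrast the failure of both sentences' inputs at the
  identity-twist diagonal setting (`LogFrobeniusLogWallTSIndependence.lean`, `LogFrobeniusNotSimCompatIndependence.lean`).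

Refereed pre-IUT material; kernel constructions over the cell's MLF model; nothing here bears on [IUTchIII] Cor. 3.12;
no side taken; typed ≠ proved; model-level ≠ node-level.
-/

set_option autoImplicit false

noncomputable section

universe u

open CategoryTheory

namespace Literature.AnabelianGeometry.AbsoluteAnabelian

open AbsTopIII

/-! ## The underlying arithmetic datum of a local `TS`-pair -/

/-- The set-valued functor `(Π ↷ M) ↦ M`, `(φ_Π, φ_M) ↦ φ_M` on abc-iut-L4-t9's model `TS`-pairs.
[cite: MochizukiAbsTopIII2015, Definition 3.1 (ii) p.67] -/
def AbsTopIII.TSObj.forgetM : TSObj ⥤ Type where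
  obj P := P.pair.M
  map φ := TypeCat.ofHom φ.homM

variable (p : ℕ) [Fact p.Prime]

namespace LogFrobeniusSetting

/-! ## The local components of Def 5.4 (iii) at the MLF model, assembled per vertex / per edge -/

/-- `λ_ν` at the six vertices of `Γ⃗^log_non` (Def 5.4 (iii)) at the MLF model: `𝒪^×_k̄`, `k̄^×`, `k̄` (space-link),
`k~` (post-log and shell codomain; `= k̄` in log-coordinates), `(k̄^×)^pf`. [cite: MochizukiAbsTopIII2015, Definition 5.4 (iii) p.126] -/
def nonarchLoc : NonarchVertex → (TFModel p ⥤ TSObj)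
  | .units => TFModel.lamUnits p
  | .mult => TFModel.lamTimes p
  | .spaceLink => TFModel.lamAdd p
  | .postLog => TFModel.lamAdd p
  | .shellCod => TFModel.lamAdd p
  | .perf => TFModel.lamTimesPf p

/-- `ι_ε` along the six arrows of `Γ⃗^log_non` at the MLF model (`MLFLogFrobeniusNonarchArrows.lean` and
abc-iut-L4-t9's `ι_×`). [cite: MochizukiAbsTopIII2015, Definition 5.4 (iii) p.126] -/
def nonarchLocIota : {ν₁ ν₂ : NonarchVertex} → NonarchEdge ν₁ ν₂ → (nonarchLoc p ν₁ ⟶ nonarchLoc p ν₂)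
  | _, _, .unitsToMult => TFModel.iotaUnitsToTimes p
  | _, _, .multToSpaceLink => TFModel.iotaTimesToAdd p
  | _, _, .shell => TFModel.iotaShell p
  | _, _, .multToPerf => TFModel.iotaTimes p
  | _, _, .postLogId => 𝟙 (TFModel.lamAdd p)
  | _, _, .shellCodToPerf => TFModel.iotaAddToPf p

/-- `λ⊞_{v,ν} : 𝒳 → 𝒩⊞_v = 𝒳 × 𝒞_TS`, `A ↦ (A, λ_ν(A))` (print: into the fibred product `𝒞_{TS⊞} ×_{TG} Th•[Z]`); at an
ARCHIMEDEAN place of THIS setting the constant choice `λ_{k̄}` (PLACEHOLDER). [cite: MochizukiAbsTopIII2015, Definition 5.4 (iv) p.127] -/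
def nonarchLam : (b : Bool) → LogVertex b → (Up (TFModel p) ⥤ Up (TFModel p × TSObj))
  | false, ν => Up.liftF ((𝟭 (TFModel p)).prod' (nonarchLoc p ν))
  | true, _ => Up.liftF ((𝟭 (TFModel p)).prod' (TFModel.lamAdd p))

/-- `ι_{v,ε}` before the twist, for ALL edges: `(𝟙, ι_ε)` at a nonarchimedean place; identity at an archimedean place
of THIS setting (PLACEHOLDER). [cite: MochizukiAbsTopIII2015, Definition 5.4 (vii) p.128] -/
def nonarchIotaCore : (b : Bool) → {ν₁ ν₂ : LogVertex b} → LogEdgeTS b ν₁ ν₂ → (nonarchLam p b ν₁ ⟶ nonarchLam p b ν₂)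
  | false, _, _, ε => Up.liftT (NatTrans.prod' (𝟙 (𝟭 (TFModel p))) (nonarchLocIota p ε))
  | true, _, _, _ => 𝟙 _

/-- `Λ_ν ∘ λ = λ` for the identity log-Frobenius functor (log-coordinates). [cite: MochizukiAbsTopIII2015, Def 5.4 (vii) p. 128] -/
theorem frobeniusTwist_id_comp' (c : Bool) (F : Up (TFModel p) ⥤ Up (TFModel p × TSObj)) :
    frobeniusTwist (𝟭 (Up (TFModel p))) c ⋙ F = F := by
  cases c <;> rfl

/-- `ι⊞_{v,ε}` of the model on `Γ⃗^⋉_v`: the canonical identification `Λ_{ν₁} ∘ λ⊞ = λ⊞` followed by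
`nonarchIotaCore` of the underlying edge. [cite: MochizukiAbsTopIII2015, Definition 5.4 (vii) p.128] -/
def nonarchIota (b : Bool) {ν₁ ν₂ : LogVertex b} (ε : LogEdge b ν₁ ν₂) :
    frobeniusTwist (𝟭 (Up (TFModel p))) ν₁.isPostLog ⋙ nonarchLam p b ν₁ ⟶ nonarchLam p b ν₂ :=
  eqToHom (frobeniusTwist_id_comp' p _ _) ≫ nonarchIotaCore p b ε.toTS

/-- `TS`-valued `ι_{v,ε}` of the model for ALL edges of `Γ⃗^log_v` (`𝒩⊞_v → 𝒩_v` is the identity in the model).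
[cite: MochizukiAbsTopIII2015, Definition 5.4 (vii) p.128] -/
def nonarchIotaTS (b : Bool) {ν₁ ν₂ : LogVertex b} (ε : LogEdgeTS b ν₁ ν₂) :
    (frobeniusTwist (𝟭 (Up (TFModel p))) ν₁.isPostLog ⋙ nonarchLam p b ν₁) ⋙ 𝟭 (Up (TFModel p × TSObj)) ⟶
      nonarchLam p b ν₂ ⋙ 𝟭 (Up (TFModel p × TSObj)) :=
  eqToHom (by rw [frobeniusTwist_id_comp']) ≫ Functor.whiskerRight (nonarchIotaCore p b ε) (𝟭 _)

/-- Whiskering a canonical identification is the canonical identification. [folklore] -/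
private theorem whiskerRight_eqToHom' {C D E : Type*} [Category C] [Category D] [Category E] {G G' : C ⥤ D}
    (h : G = G') (F : D ⥤ E) : Functor.whiskerRight (eqToHom h) F = eqToHom (by rw [h]) := by
  subst h
  simp [Functor.whiskerRight_id']

/-- On `Γ⃗^⋉_v` the `TS`-valued homotopy is `ι⊞` composed with `𝒩⊞_v → 𝒩_v` (Def 5.4 (vii)).
[cite: MochizukiAbsTopIII2015, Definition 5.4 (vii) p.128] -/
theorem nonarchIotaTS_toTS (b : Bool) {ν₁ ν₂ : LogVertex b} (ε : LogEdge b ν₁ ν₂) :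
    nonarchIotaTS p b ε.toTS = Functor.whiskerRight (nonarchIota p b ε) (𝟭 (Up (TFModel p × TSObj))) := by
  simp only [nonarchIotaTS, nonarchIota, Functor.whiskerRight_comp, whiskerRight_eqToHom']

/-- The space-link and post-log functors coincide (`k̄` and `k~` in log-coordinates), at every place.
[cite: MochizukiAbsTopIII2015, Cor 5.5 p. 130] -/
theorem nonarchLam_spaceLink_eq_postLog (b : Bool) :
    nonarchLam p b (LogVertex.spaceLink b) = nonarchLam p b (LogVertex.postLog b) := by
  cases b <;> rfl

/-- `λ⊞_{v,ν}` lies over the base: `(A, λ_ν(A)) ↦ A` is the identity. [cite: MochizukiAbsTopIII2015, Definition 5.4 (iv) p.127] -/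
def nonarchLamOver : (b : Bool) → (ν : LogVertex b) →
    (nonarchLam p b ν ⋙ 𝟭 (Up (TFModel p × TSObj)) ⋙ Up.liftF (CategoryTheory.Prod.fst (TFModel p) TSObj) ≅
      𝟭 (Up (TFModel p)))
  | false, _ => NatIso.ofComponents (fun _ => Iso.refl _) (fun _ => InducedCategory.hom_ext (by
      simp only [Functor.comp_map, Functor.id_map]; rfl))
  | true, _ => NatIso.ofComponents (fun _ => Iso.refl _) (fun _ => InducedCategory.hom_ext (by
      simp only [Functor.comp_map, Functor.id_map]; rfl))

/-- **The global log-Frobenius setting with GENUINE NONARCHIMEDEAN COMPONENTS** (module docstring): `𝒳 := TFModel p`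
(lifted), `log := 𝟭`, `𝒩⊞_v = 𝒩_v := 𝒳 × 𝒞_TS`, `λ⊞_{v,ν} = (𝟭, λ_ν)`, `ι⊞ = (𝟙, ι_ε)` from Def 5.4 (iii) at the MLF
model; PLACEHOLDERS: `ℰ• := 𝒳`, `An• := 𝒳` (identity equivalences), archimedean components, mono-analytic side.
[cite: MochizukiAbsTopIII2015, Definition 5.4 (iv) p.127] -/
def nonarchGenuine (Vmod : Type 1) (isArc : Vmod → Bool) : LogFrobeniusSetting Vmod isArc where
  X := Up (TFModel p)
  E := Up (TFModel p)
  proj := 𝟭 _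
  log := 𝟭 _
  logIsoId := Iso.refl _
  logOver := Iso.refl _
  Nplus _ := Up (TFModel p × TSObj)
  N _ := Up (TFModel p × TSObj)
  forget _ := 𝟭 _
  toE _ := Up.liftF (CategoryTheory.Prod.fst (TFModel p) TSObj)
  lam v := nonarchLam p (isArc v)
  lamOver v := nonarchLamOver p (isArc v)
  lam_spaceLink_eq_postLog v := nonarchLam_spaceLink_eq_postLog p (isArc v)
  iota v _ _ ε := nonarchIota p (isArc v) ε
  An := Up (TFModel p)
  κAn := CategoryTheory.Equivalence.refl
  φAn := 𝟭 _
  φAn_isEquivalence := inferInstance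
  ηAn := Iso.refl _
  κAn₂ := CategoryTheory.Equivalence.refl
  Emono := Up (TFModel p)
  monoAn := 𝟭 _
  NmonoPlus _ := Up (TFModel p × TSObj)
  Nmono _ := Up (TFModel p × TSObj)
  forgetMono _ := 𝟭 _
  toEmono _ := Up.liftF (CategoryTheory.Prod.fst (TFModel p) TSObj)
  monoNplus _ := 𝟭 _
  monoN _ := 𝟭 _
  monoHomotopy _ := Iso.refl _
  AnMono := Up (TFModel p)
  κAnMono := CategoryTheory.Equivalence.refl
  ψAnMono _ _ := Up.liftF ((𝟭 (TFModel p)).prod' (TFModel.lamTimes p))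

/-- **The `TS`-valued homotopy datum of the setting with genuine nonarchimedean components** (all six arrows of
Def 5.4 (iii), including the `TS`-only `k̄^× ↪ k̄`; `ι|_{Γ⃗^⋉} = ι⊞`). [cite: MochizukiAbsTopIII2015, Definition 5.4 (vii) p.128] -/
def nonarchGenuineTS (Vmod : Type 1) (isArc : Vmod → Bool) : (nonarchGenuine p Vmod isArc).TSHomotopies where
  iota v _ _ ε := nonarchIotaTS p (isArc v) ε
  iota_toTS v _ _ ε := nonarchIotaTS_toTS p (isArc v) ε

/-! ## Cor 5.5 (iv), sentences 1 and 2, at the model -/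

/-- The set-valued functor used as `Ψ`: the arithmetic datum `M` of the local `TS`-pair of an object `(A, (Π ↷ M))` of
`𝒩_v = 𝒳 × 𝒞_TS`. [cite: MochizukiAbsTopIII2015, Definition 5.4 (iv) p.127] -/
def nonarchΨ : Up (TFModel p × TSObj) ⥤ Type :=
  inducedFunctor _ ⋙ CategoryTheory.Prod.snd (TFModel p) TSObj ⋙ AbsTopIII.TSObj.forgetM

/-- In the (unique) two-path configuration of `Γ⃗^log_non` — `𝒪^× ↪ k̄^× ↪ k̄`, `k~ →(id) k~` versus the shell-arrow
`𝒪^× →(log) k~` — the model's `TS`-arrows have injective underlying maps along the first path and a non-injective one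
along the shell-arrow (the genuine `log_k̄` kills `𝒪^μ_k̄`).  Stated for a Boolean `b = false` so that it applies to
`b := isArc v₀` without transport. [cite: MochizukiAbsTopIII2015, Definition 5.4 (iii) p.126] -/
theorem nonarchIotaTS_twoPath (b : Bool) (hb : b = false) (νu νm νc : LogVertex b)
    (ε₁ : LogEdgeTS b νu νm) (ε₂ : LogEdgeTS b νm (LogVertex.spaceLink b))
    (ε₃ : LogEdgeTS b (LogVertex.postLog b) νc) (ε₄ : LogEdgeTS b νu νc) (x₀ : Up (TFModel p)) :
    Function.Injective ((nonarchΨ p).map ((nonarchIotaTS p b ε₁).app x₀) : _ → _) ∧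
      Function.Injective ((nonarchΨ p).map ((nonarchIotaTS p b ε₂).app x₀) : _ → _) ∧
        Function.Injective ((nonarchΨ p).map ((nonarchIotaTS p b ε₃).app x₀) : _ → _) ∧
          ¬ Function.Injective ((nonarchΨ p).map ((nonarchIotaTS p b ε₄).app x₀) : _ → _) := by
  subst hb
  match νu, νm, νc, ε₁, ε₂, ε₃, ε₄ with
  | _, _, _, NonarchEdge.unitsToMult, NonarchEdge.multToSpaceLink, NonarchEdge.postLogId, NonarchEdge.shell =>
    simp only [nonarchIotaTS, NatTrans.comp_app, eqToHom_app, Functor.whiskerRight_app, Functor.id_map]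
    exact ⟨TFModel.iotaUnitsToTimes_injective p x₀.down, TFModel.iotaTimesToAdd_injective p x₀.down,
      TFModel.iotaPostLogId_injective p x₀.down, TFModel.iotaShell_not_injective p x₀.down⟩

/-- **[AbsTopIII] Cor 5.5 (iv), print-faithful sentences 1 AND 2, HOLD at the setting with genuine nonarchimedean
components** (with its own `TS`-datum), over every index set with a nonarchimedean place `v₀` and for every model
`TF`-pair `x₀`: "`D•_{≤2}` does not admit a structure of core on `D•_{≤1}` compatible with the observables `S_log`,
`S_log⊞`" (`Cor55LogWall`, F-3082) and "`𝔗_{An•}`, `ℋ_{An•}`, `S_log`, `S_log⊞` are not simultaneously compatible"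
(`Cor55NotSimultaneouslyCompatible`, F-3190) — from the Lemma-3.4 mechanism made set-theoretic
(`cor55LogWall_and_notSimCompat_of_iota_injective`): `𝒪^× ↪ k̄^× ↪ k̄`, `k~ →(id) k~` injective, `log_k̄` not.
MODEL-LEVEL (module docstring: `ℰ•`, `An•`, the archimedean components and the mono-analytic side are placeholders).
[cite: MochizukiAbsTopIII2015, Cor 5.5 (iv) p. 131] -/
theorem nonarchGenuine_cor55LogWall_and_notSimCompat (Vmod : Type 1) (isArc : Vmod → Bool) (v₀ : Vmod)
    (hv₀ : isArc v₀ = false) (x₀ : Up (TFModel p)) :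
    (nonarchGenuine p Vmod isArc).Cor55LogWall (nonarchGenuineTS p Vmod isArc) ∧
      (nonarchGenuine p Vmod isArc).Cor55NotSimultaneouslyCompatible (nonarchGenuineTS p Vmod isArc) :=
  (nonarchGenuine p Vmod isArc).cor55LogWall_and_notSimCompat_of_iota_injective (nonarchGenuineTS p Vmod isArc)
    v₀ hv₀ x₀ (nonarchΨ p)
    (fun νu νm νc _ _ _ ε₁ ε₂ ε₃ ε₄ => nonarchIotaTS_twoPath p (isArc v₀) hv₀ νu νm νc ε₁ ε₂ ε₃ ε₄ x₀)

/-- Existence form: over every index set (universe `1`) with a nonarchimedean place there is a setting with a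
`TS`-datum at which BOTH print-faithful sentences of Cor 5.5 (iv) hold — the antecedents of abc-iut-w5-d097's
reductions are met by print's own arrows, not only by degenerate twists. [cite: MochizukiAbsTopIII2015, Cor 5.5 (iv) p. 131] -/
theorem exists_cor55LogWall_and_notSimCompat_nonarchGenuine (Vmod : Type 1) (isArc : Vmod → Bool) (v₀ : Vmod)
    (hv₀ : isArc v₀ = false) (A : TFModel p) :
    ∃ (L : LogFrobeniusSetting Vmod isArc) (T : L.TSHomotopies),
      L.X = Up (TFModel p) ∧ L.Cor55LogWall T ∧ L.Cor55NotSimultaneouslyCompatible T :=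
  ⟨nonarchGenuine p Vmod isArc, nonarchGenuineTS p Vmod isArc, rfl,
    nonarchGenuine_cor55LogWall_and_notSimCompat p Vmod isArc v₀ hv₀ (ULift.up A)⟩

/-! ## Cor 5.5 (iii), `⊞`-half, at the model: the printed square of Def 5.4 (iii) COMMUTES (appended) -/

/-- **The square `𝒪^× ↪ k̄^× → (k̄^×)^pf` / `𝒪^× →(log) k~ ↪ (k̄^×)^pf` of Def 5.4 (iii) COMMUTES at the MLF model**:
in log-shell coordinates `[u] = [log_k̄⁻¹(log_k̄ u)]` for `u ∈ 𝒪^×_k̄` (abc-iut-L6-d2's `logEquiv_mk`) — the "commutative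
diagram" by which print DEFINES `Γ⃗^log_non`, here a theorem about the genuine arrows of `MLFLogFrobeniusNonarchArrows.lean`.
[cite: MochizukiAbsTopIII2015, Definition 5.4 (iii) p.126] -/
theorem TFModel_iotaSquare_comm (A : TFModel p) :
    (TFModel.iotaUnitsToTimes p).app A ≫ (TFModel.iotaTimes p).app A =
      (TFModel.iotaShell p).app A ≫ (TFModel.iotaAddToPf p).app A := by
  refine TSObj.Hom.ext rfl (funext fun u => ?_)
  change timesToPf (TFModel.UnitsCarrier.toTimes u) =
    unitsPfIncl ((padicLog p).logEquiv.symm (Multiplicative.ofAdd ((padicLog p).log u.val)))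
  have hw : (padicLog p).logEquiv.symm (Multiplicative.ofAdd ((padicLog p).log u.val)) =
      QuotientGroup.mk (⟨Units.mk0 u.val (ne_zero_of_mem_unitSubmonoid u.val_mem), u.val_mem⟩ :
        unitGroup ℚ_[p] (PadicAlgCl p)) := by
    apply (padicLog p).logEquiv.injective
    rw [MulEquiv.apply_symm_apply, GaloisPadicLog.logEquiv_mk]
    rfl
  rw [hw, unitsPfIncl_mk]
  rfl

/-- The `ι⊞`-squares of the model commute at a NONARCHIMEDEAN place (abc-iut-f-101's print-quoting condition
`IotaSquaresCommute`, in its `HEq`-cast form; stated for a Boolean `b = false`): the only parallel 2-chains of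
`Γ⃗^⋉_non` between pre-log vertices are the two sides of the printed square (and a chain with itself), where
`TFModel_iotaSquare_comm` applies. [cite: MochizukiAbsTopIII2015, Definition 5.4 (iii) p.126] -/
theorem nonarchIota_squaresCommute (b : Bool) (hb : b = false) ⦃ν₁ ν₂ ν₂' ν₃ : LogVertex b⦄
    (h₁ : ν₁.isPostLog = false) (_h₂ : ν₂.isPostLog = false) (_h₂' : ν₂'.isPostLog = false)
    (_h₃ : ν₃.isPostLog = false) (ε₁₂ : LogEdge b ν₁ ν₂) (ε₂₃ : LogEdge b ν₂ ν₃) (ε₁₂' : LogEdge b ν₁ ν₂')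
    (ε₂'₃ : LogEdge b ν₂' ν₃) (X₀ : Up (TFModel p))
    (m₁₂ : (nonarchLam p b ν₁).obj X₀ ⟶ (nonarchLam p b ν₂).obj X₀)
    (m₂₃ : (nonarchLam p b ν₂).obj X₀ ⟶ (nonarchLam p b ν₃).obj X₀)
    (m₁₂' : (nonarchLam p b ν₁).obj X₀ ⟶ (nonarchLam p b ν₂').obj X₀)
    (m₂'₃ : (nonarchLam p b ν₂').obj X₀ ⟶ (nonarchLam p b ν₃).obj X₀)
    (hm₁₂ : HEq m₁₂ ((nonarchIota p b ε₁₂).app X₀)) (hm₂₃ : HEq m₂₃ ((nonarchIota p b ε₂₃).app X₀))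
    (hm₁₂' : HEq m₁₂' ((nonarchIota p b ε₁₂').app X₀)) (hm₂'₃ : HEq m₂'₃ ((nonarchIota p b ε₂'₃).app X₀)) :
    m₁₂ ≫ m₂₃ = m₁₂' ≫ m₂'₃ := by
  subst hb
  obtain ⟨e₁₂, he₁₂⟩ := ε₁₂
  obtain ⟨e₂₃, he₂₃⟩ := ε₂₃
  obtain ⟨e₁₂', he₁₂'⟩ := ε₁₂'
  obtain ⟨e₂'₃, he₂'₃⟩ := ε₂'₃
  cases e₁₂ <;> cases e₂₃ <;> cases e₁₂' <;> cases e₂'₃ <;>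
    first
    | exact absurd h₁ (by decide)
    | exact False.elim he₂₃
    | (simp only [nonarchIota, nonarchIotaCore, LogEdge.toTS, NatTrans.comp_app, eqToHom_app,
        heq_eqToHom_comp_iff] at hm₁₂ hm₂₃ hm₁₂' hm₂'₃
       obtain rfl := eq_of_heq hm₁₂
       obtain rfl := eq_of_heq hm₂₃
       obtain rfl := eq_of_heq hm₁₂'
       obtain rfl := eq_of_heq hm₂'₃
       first
       | rfl
       | (apply InducedCategory.hom_ext
          apply Prod.hom_ext
          · rfl
          · first
            | exact TFModel_iotaSquare_comm p X₀.down
            | exact (TFModel_iotaSquare_comm p X₀.down).symm))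

/-- **abc-iut-f-101's `IotaSquaresCommute` HOLDS at every place of the setting with genuine nonarchimedean
components** (nonarchimedean places: `nonarchIota_squaresCommute`; archimedean places: automatic,
`iotaSquaresCommute_of_isArc`). [cite: MochizukiAbsTopIII2015, Definition 5.4 (iii) p.126] -/
theorem nonarchGenuine_iotaSquaresCommute (Vmod : Type 1) (isArc : Vmod → Bool) (v : Vmod) :
    (nonarchGenuine p Vmod isArc).IotaSquaresCommute v := by
  cases hb : isArc v
  · exact fun ν₁ ν₂ ν₂' ν₃ h₁ h₂ h₂' h₃ ε₁₂ ε₂₃ ε₁₂' ε₂'₃ X₀ m₁₂ m₂₃ m₁₂' m₂'₃ =>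
      nonarchIota_squaresCommute p (isArc v) hb h₁ h₂ h₂' h₃ ε₁₂ ε₂₃ ε₁₂' ε₂'₃ X₀ m₁₂ m₂₃ m₁₂' m₂'₃
  · exact (nonarchGenuine p Vmod isArc).iotaSquaresCommute_of_isArc v hb

/-- **[AbsTopIII] Cor 5.5 (iii), `⊞`-half (`Cor55Observables`, FACT-LIST F-0142), HOLDS at the setting with genuine
nonarchimedean components**: the observables `S_log⊞` exist at every `v` — by abc-iut-f-101's
`cor55Observables_of_iotaSquaresCommute` (F-0142 ⟺ the `ι⊞`-squares commute) and the commuting printed square of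
Def 5.4 (iii) at the model.  MODEL-LEVEL (module docstring); contrast: at abc-iut-f-101's twisted setting F-0142 FAILS
(`LogFrobeniusObservablesIotaSquare.lean`) — there the square does not commute; here print's arrows make it commute.
[cite: MochizukiAbsTopIII2015, Cor 5.5 (iii) p. 131] -/
theorem nonarchGenuine_cor55Observables (Vmod : Type 1) (isArc : Vmod → Bool) :
    (nonarchGenuine p Vmod isArc).Cor55Observables :=
  (nonarchGenuine p Vmod isArc).cor55Observables_of_iotaSquaresCommute
    (nonarchGenuine_iotaSquaresCommute p Vmod isArc)

end LogFrobeniusSetting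

end Literature.AnabelianGeometry.AbsoluteAnabelian
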